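import Summits.QuantumAdvantage.QuantumAdvantage.Theorems.SosSandwichTransferPBPathBoundChainFinal
import Summits.QuantumAdvantage.QuantumAdvantage.Theorems.SosSandwichQueryRestrict
import Summits.QuantumAdvantage.QuantumAdvantage.Theorems.SosSandwichQueryLevelDescentLine
import HarnessLib

/-!
# Route `SosSandwich`: from the circuit→query bridge to the summit — `AA_Q ⟹ AApath` (downstream half)

Support file for crux `PseudoBoundedAA` (stmt-QuantumAdvantage-15237), item (1) of the g9 repair census, DOWNSTREAM
HALF (the bridge proper — oracle circuit ⟹ `QQueryAlg` with the same acceptance probability — is built by the sibling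
hand and enters here as the INLINE hypothesis `Bridge`, stated in the weakest form this file needs):

  `Bridge := ∀ F x, 0 < numOracleBits F x → ∃ Q : QQueryAlg (numOracleBits F x),
              Q.queries ≤ thm23Degree F x ∧ ∀ b, Q.acceptProb b = evalBool (acceptPoly F x) b`.

Content (all sorry-free, standard axioms):

* `exists_alg_restrictPath` — the class `Q_T` is closed under restriction along paths of revealed bits (iterating the
  tree's one-bit `QueryRestrict.restrictAlg`: same number of queries, `evalBool (restrictPath ρ p) = acceptProb A'`
  whenever `evalBool p = acceptProb A`);
* `boolVariance_eq_zero_of_const` — the two degenerate cases (no oracle bit; no query) have variance `0`;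
* **`pathBound_of_aaQuery_of_bridge : Bridge → AA_Q → AApath`** with the SAME constants `(c, C)`: the path-wise
  Aaronson–Ambainis bound for restrictions of Clifford+T oracle-circuit acceptance polynomials (the hypothesis of
  `SimTreePB.transfer_of_pathBound`) follows from the influence conjecture for quantum QUERY acceptance probabilities
  (`AA_Q`, the hypothesis of `QueryRestrict.quantumQuerySimulable_of_aaQuery`), because `q ≤ 2q+1 = thm23Degree`;
* `transfer_of_aaQuery_of_bridge`, **`quantumAdvantage_of_aaQuery_of_bridge`** (`Bridge → AA_Q → X_ROG → PL →
  QuantumAdvantage`) and `quantumAdvantage_of_levelDescentQ_of_bridge` (∘ `QueryTopLevel.aaQuery_of_levelDescentQ`):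
  granted the bridge, the analytic crux of route SosSandwich is EXACTLY the Aaronson–Ambainis conjecture for quantum
  query algorithms (`AA_Q`; open — AaronsonAmbainis2014 Conj. 6 restricted to `Q_T`, cf. Thm. 7), resp. level
  descent inside `Q_T`.

Honest label: glue / reduction; no stub, crux or summit is proved here.  Sources: AaronsonAmbainis2014 Thm. 7 (iii),
Thm. 21, Thm. 23; BealsEtAl2001 §2 (the query model); BuhrmanDeWolf2002 (bib: Wolf2002) §3 (fixing input bits).
-/

noncomputable section

-- D-0017: single-conjunct summit ⇒ the duplicate `QuantumAdvantage.QuantumAdvantage` is mandated.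
set_option linter.dupNamespace false

namespace Summit.QuantumAdvantage.QuantumAdvantage.Theorems.SosSandwich.QueryPathBridge

open MeasureTheory Literature.Computability.Cryptography Literature.Computability.Complexity
  Literature.Computability.QuantumComplexity
open Summit.QuantumAdvantage.QuantumAdvantage.Theses.SosSandwich
open Summit.QuantumAdvantage.QuantumAdvantage.Cruxes.TransferPB.Birth
open Summit.QuantumAdvantage.QuantumAdvantage.Theorems.SosSandwich.QueryRestrict
open scoped ENNReal

variable {N : ℕ}

/-! ### `Q_T` is closed under restriction along a path -/

/-- **`Q_T` is closed under restriction along paths**: if `p` has the cube values of a `T`-query algorithm `A`, then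
`restrictPath ρ p` has the cube values of some `T`-query algorithm (iterate the tree's one-bit restriction
`QueryRestrict.restrictAlg` — one ancilla qubit per revealed bit — with `restrictAlg_acceptProb` and
`evalBool_restrictPoly`). [cite: Wolf2002, §3] [cite: AaronsonAmbainis2014, Thm. 21 (proof: restrictions p_j)] -/
theorem exists_alg_restrictPath : ∀ (ρ : List (Fin N × Bool)) (A : QQueryAlg N) (p : MvPolynomial (Fin N) ℝ),
    (∀ b, evalBool p b = A.acceptProb b) →
      ∃ A' : QQueryAlg N, A'.queries = A.queries ∧ ∀ b, evalBool (SimTreePB.restrictPath ρ p) b = A'.acceptProb b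
  | [], A, _, h => ⟨A, rfl, h⟩
  | e :: ρ, A, p, h => by
    obtain ⟨A', hq, hA'⟩ := exists_alg_restrictPath ρ (restrictAlg A e.1 e.2) (restrictPoly e.1 e.2 p)
      (fun b => by rw [evalBool_restrictPoly, h, restrictAlg_acceptProb])
    exact ⟨A', hq, hA'⟩

/-! ### Degenerate cases: constant cube values have variance zero -/

/-- A polynomial with constant cube values has variance `0`. [folklore] -/
theorem boolVariance_eq_zero_of_const (p : MvPolynomial (Fin N) ℝ) (h : ∀ x y, evalBool p x = evalBool p y) :
    boolVariance p = 0 := by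
  have hc : evalBool p = fun _ => evalBool p (fun _ => false) := funext fun x => h x _
  unfold boolVariance
  rw [hc, boolAvg_const]
  simp only [sub_self, zero_pow two_ne_zero, boolAvg_const]

/-- No oracle bit (`N = 0`): every polynomial has variance `0` on the one-point cube. [folklore] -/
theorem boolVariance_eq_zero_of_eq_zero (hN : N = 0) (p : MvPolynomial (Fin N) ℝ) : boolVariance p = 0 :=
  boolVariance_eq_zero_of_const p fun x y => by
    rw [show x = y from funext fun i => absurd i.isLt (by omega)]

/-- No query: the restriction of the acceptance polynomial of a `0`-query algorithm along any path has variance `0`.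
[cite: BealsEtAl2001, Lemma 4.1] -/
theorem boolVariance_restrictPath_eq_zero_of_queries_eq_zero (A : QQueryAlg N) (hA : A.queries = 0)
    (p : MvPolynomial (Fin N) ℝ) (hp : ∀ b, evalBool p b = A.acceptProb b) (ρ : List (Fin N × Bool)) :
    boolVariance (SimTreePB.restrictPath ρ p) = 0 := by
  obtain ⟨A', hq, hA'⟩ := exists_alg_restrictPath ρ A p hp
  exact boolVariance_eq_zero_of_const _ fun x y => by
    rw [hA', hA']
    exact PBAAQuerySimulable.acceptProb_const_of_queries_eq_zero _ (hq.trans hA) x y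

/-! ### `Bridge → AA_Q → AApath` and the summit assembly -/

/-- **The path-wise Aaronson–Ambainis bound from the quantum-query influence conjecture**, granted the circuit→query
bridge.  `Bridge` (first hypothesis, inline): every Clifford+T oracle circuit at input `x` with at least one relevant
oracle bit is, as a function of the relevant oracle bits, the acceptance probability of a quantum query algorithm with at
most `thm23Degree F x = 2·#oracle gates + 1` queries.  `AA_Q` (second hypothesis, inline, shape of
`QueryRestrict.quantumQuerySimulable_of_aaQuery`): every `T ≥ 1`-query acceptance polynomial with `Var ≥ ε > 0` has a
variable of influence `≥ C (ε/T)^c`.  Conclusion: `AApath` (hypothesis of `SimTreePB.transfer_of_pathBound`) with the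
same `(c, C)` — restrictions stay in `Q_T` (`exists_alg_restrictPath`), `T ≤ thm23Degree`, and the degenerate cases
have variance `0`. [cite: AaronsonAmbainis2014, Thm. 7 (i)/(iii) and Thm. 23 (proof)] -/
theorem pathBound_of_aaQuery_of_bridge
    (hB : ∀ (F : QCircuitFamily cliffordT) (x : List Bool), 0 < numOracleBits F x →
      ∃ Q : QQueryAlg (numOracleBits F x), Q.queries ≤ thm23Degree F x ∧
        ∀ b, Q.acceptProb b = evalBool (acceptPoly F x) b)
    (hAAQ : ∃ (c : ℕ) (C : ℝ), 0 < C ∧ ∀ (N : ℕ) (Q : QQueryAlg N) (p : MvPolynomial (Fin N) ℝ) (ε : ℝ),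
      1 ≤ Q.queries → (∀ x, evalBool p x = Q.acceptProb x) → 0 < ε → ε ≤ boolVariance p →
        ∃ i : Fin N, C * (ε / Q.queries) ^ c ≤ influence i p) :
    ∃ (c : ℕ) (C₀ : ℝ), 0 < C₀ ∧ ∀ (F : QCircuitFamily cliffordT) (x : List Bool)
      (ρ : List (Fin (numOracleBits F x) × Bool)) (ε : ℝ), 0 < ε →
      ε ≤ boolVariance (SimTreePB.restrictPath ρ (acceptPoly F x)) →
        ∃ i : Fin (numOracleBits F x),
          C₀ * (ε / thm23Degree F x) ^ c ≤ influence i (SimTreePB.restrictPath ρ (acceptPoly F x)) := by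
  obtain ⟨c, C, hC, H⟩ := hAAQ
  refine ⟨c, C, hC, fun F x ρ ε hε hv => ?_⟩
  rcases Nat.eq_zero_or_pos (numOracleBits F x) with hN0 | hNpos
  · exfalso
    have h0 := boolVariance_eq_zero_of_eq_zero hN0 (SimTreePB.restrictPath ρ (acceptPoly F x))
    linarith
  obtain ⟨Q, hQdeg, hQacc⟩ := hB F x hNpos
  rcases Nat.eq_zero_or_pos Q.queries with hq0 | hqpos
  · exfalso
    have h0 := boolVariance_restrictPath_eq_zero_of_queries_eq_zero Q hq0 (acceptPoly F x)
      (fun b => (hQacc b).symm) ρ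
    linarith
  obtain ⟨Q', hq, hacc⟩ := exists_alg_restrictPath ρ Q (acceptPoly F x) fun b => (hQacc b).symm
  obtain ⟨i, hi⟩ := H _ Q' _ ε (by omega) hacc hε hv
  refine ⟨i, le_trans ?_ hi⟩
  rw [hq]
  have hqpos' : (0 : ℝ) < Q.queries := by exact_mod_cast hqpos
  have hle : (Q.queries : ℝ) ≤ thm23Degree F x := by exact_mod_cast hQdeg
  have hε0 : 0 ≤ ε := hε.le
  gcongr

/-- **`TransferPB` from `AA_Q`**, granted the bridge: if `PromiseBQP ⊆ PromiseBPP'` then `BQP^A ⊆ AvgP^A` for almost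
every random oracle `A` (∘ `SimTreePB.transfer_of_pathBound`). [cite: AaronsonAmbainis2014, Thm. 7 (iii), Thm. 23] -/
theorem transfer_of_aaQuery_of_bridge
    (hB : ∀ (F : QCircuitFamily cliffordT) (x : List Bool), 0 < numOracleBits F x →
      ∃ Q : QQueryAlg (numOracleBits F x), Q.queries ≤ thm23Degree F x ∧
        ∀ b, Q.acceptProb b = evalBool (acceptPoly F x) b)
    (hAAQ : ∃ (c : ℕ) (C : ℝ), 0 < C ∧ ∀ (N : ℕ) (Q : QQueryAlg N) (p : MvPolynomial (Fin N) ℝ) (ε : ℝ),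
      1 ≤ Q.queries → (∀ x, evalBool p x = Q.acceptProb x) → 0 < ε → ε ≤ boolVariance p →
        ∃ i : Fin N, C * (ε / Q.queries) ^ c ≤ influence i p)
    (hPr : Literature.Computability.Cryptography.PromiseBQP ⊆ Literature.Computability.Complexity.PromiseBPP') :
    ∀ᵐ A ∂randomOracle,
      BQPRel (A : Language Bool) ⊆
        Literature.Computability.Complexity.AvgPRel (Oracle.ofLanguage (A : Language Bool)) :=
  SimTreePB.transfer_of_pathBound (pathBound_of_aaQuery_of_bridge hB hAAQ) hPr

/-- **The summit assembly of route SosSandwich with analytic crux `AA_Q`**, granted the bridge: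
`Bridge → AA_Q → RandomOracleHeurSeparation → PromiseLanguageLift → QuantumAdvantage`
(∘ `SimTreePB.quantumAdvantage_of_pathBound`). [cite: AaronsonAmbainis2014, Thm. 7 (iii)] -/
theorem quantumAdvantage_of_aaQuery_of_bridge
    (hB : ∀ (F : QCircuitFamily cliffordT) (x : List Bool), 0 < numOracleBits F x →
      ∃ Q : QQueryAlg (numOracleBits F x), Q.queries ≤ thm23Degree F x ∧
        ∀ b, Q.acceptProb b = evalBool (acceptPoly F x) b)
    (hAAQ : ∃ (c : ℕ) (C : ℝ), 0 < C ∧ ∀ (N : ℕ) (Q : QQueryAlg N) (p : MvPolynomial (Fin N) ℝ) (ε : ℝ),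
      1 ≤ Q.queries → (∀ x, evalBool p x = Q.acceptProb x) → 0 < ε → ε ≤ boolVariance p →
        ∃ i : Fin N, C * (ε / Q.queries) ^ c ≤ influence i p)
    (hX : RandomOracleHeurSeparation) (hPL : PromiseLanguageLift) : _root_.QuantumAdvantage :=
  SimTreePB.quantumAdvantage_of_pathBound (pathBound_of_aaQuery_of_bridge hB hAAQ) hX hPL

/-- **The summit from LEVEL DESCENT INSIDE `Q_T`**, granted the bridge (∘ `QueryTopLevel.aaQuery_of_levelDescentQ`, whose
two base rungs — one query, top-homogeneous — are proved in the tree): the only open analytic piece of the `Q_T` line.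
[cite: EscuderoGutierrez2023, Cor. 1.7 and Question 4.5] [cite: AaronsonAmbainis2014, Thm. 7 (iii)] -/
theorem quantumAdvantage_of_levelDescentQ_of_bridge
    (hB : ∀ (F : QCircuitFamily cliffordT) (x : List Bool), 0 < numOracleBits F x →
      ∃ Q : QQueryAlg (numOracleBits F x), Q.queries ≤ thm23Degree F x ∧
        ∀ b, Q.acceptProb b = evalBool (acceptPoly F x) b)
    (hLD : ∃ (a : ℕ) (A B : ℝ), 0 < A ∧ 0 < B ∧
      ∀ (N : ℕ) (Q : QQueryAlg N) (p : MvPolynomial (Fin N) ℝ) (ε : ℝ),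
        1 ≤ Q.queries → (∀ x, evalBool p x = Q.acceptProb x) → 0 < ε → ε ≤ boolVariance p →
        ∃ (N' : ℕ) (Q' : QQueryAlg N') (q : MvPolynomial (Fin N') ℝ),
          1 ≤ Q'.queries ∧ Q'.queries ≤ Q.queries ∧ (∀ x, evalBool q x = Q'.acceptProb x) ∧
          (Q'.queries = 1 ∨ ∀ x : Fin N' → Bool,
            ∑ i : Fin N', (evalBool q x - evalBool q (Function.update x i (!x i))) =
              4 * (Q'.queries : ℝ) * (evalBool q x - boolAvg (evalBool q))) ∧
          A * (ε / Q.queries) ^ a ≤ boolVariance q ∧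
          ∀ i : Fin N', ∃ i' : Fin N, influence i q ≤ B * influence i' p)
    (hX : RandomOracleHeurSeparation) (hPL : PromiseLanguageLift) : _root_.QuantumAdvantage :=
  quantumAdvantage_of_aaQuery_of_bridge hB (QueryTopLevel.aaQuery_of_levelDescentQ hLD) hX hPL

end Summit.QuantumAdvantage.QuantumAdvantage.Theorems.SosSandwich.QueryPathBridge

end
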